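import Summits.RiemannHypothesis.RiemannHypothesis.Theorems.JensenPolynomialsDefs

/-!
# Route `JensenPolynomials` — TYPED STATEMENTS, part 2: the LAGUERRE–BESSEL SKELETON SIGN TEST (rung J-P (P1⁺))

**RH-FREE; this file only NAMES objects and STATES claims (`def … : Prop`, one `structure … : Prop`), no theorem.**
D-0016 extract of §2 «Mechanism-bearing (certificate) forms» of the theory seat's HOME scratch
`run/shared/lean/pub/rh-jensen/rh-jensen-theory/JensenTargets.lean` (v4.x, §2 unchanged since v1 sha16 `92fb8a1853082ea1`,
farm-checked, 0 sorry), VERBATIM in the definitions (these are the observables the column's DATA engine measured: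
`rh-jensen/DATA.md` §9 question D1 = the exact failure set `n < n_S(d)`, `d ≤ 100`, two γ-lineages; `rh-jensen/eng-3/jdb-margins/`
= the certified margin profile `μ(d,n) = min_i P(e_i)/P⁰(e_i)`, `3 ≤ d ≤ 20`, four legs, referee packet ET7 SIGNED), so that
the ξ-free SOUNDNESS half of the rung (`JensenPolynomialsSkeletonSound`, `JensenPolynomialsSkeletonLaguerre`) can be
stated against exact constants. Part 1 is `JensenPolynomialsDefs` (ranges, GORTTW's Hermite frame, the Hermite sign test).

Contents: `SkeletonCertificate P Q` (generic sign certificate at the critical points of a hyperbolic skeleton; its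
soundness is support S1, a THEOREM of `JensenPolynomialsSkeletonSound`); the Appell frame `appellPoly`; the window sequence
`windowSeq`, the Bessel parameter `skelKappaSq` / `skelKappa`, the tilt `skelTheta`, the centred Laguerre–Bessel
skeleton sequence `skeletonSeq`; the test `SkeletonSignTest γ d n`, the schema `SkeletonSignTestLaw`, the CAL-certified
targets `TheoremAlphaCert` / `TheoremAlphaCertFlat` (P1⁺, P1⁺.a). The glue G1 (test ⇒ `jensenPoly` splits) and the
Laguerre structure S2 are THEOREMS of `JensenPolynomialsSkeletonLaguerre`; no `Prop` is left here without a consumer.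

LABELS (ladder rule §5.4): every `Prop` below is a statement about the explicit real numbers `γ(n) = xiTaylorCoeff n`
(or about an arbitrary real sequence / arbitrary real polynomials); **RH-FREE**; by the barrier entries
`Literature.Barriers.RiemannHypothesis.JensenPolynomials{,ShiftUniform,Sqrt}` no such statement carries information about
RH. `TheoremAlphaCert` / `TheoremAlphaCertFlat` are CERTIFIED (CAL, interval arithmetic; rh-explicit/jensen CLOSE-NOTE) and
MEASURED (DATA §9, ET7) but are NOT tree theorems — typed here as `@[conjecture] def`, never asserted.
Nothing in this file bears on the truth of RH.
-/

noncomputable section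
-- D-0017: `Summit.RiemannHypothesis.RiemannHypothesis.…` duplicates the namespace BY DESIGN (single-problem summit).
set_option linter.dupNamespace false

namespace Summit.RiemannHypothesis.RiemannHypothesis.Theorems.JensenPolynomials

open Literature.NumberTheory.LFunctions Polynomial Finset
open scoped BigOperators Nat

/-! ## 4. Mechanism-bearing (certificate) forms — RH-FREE and NOT implied by RH to any height

Hyperbolicity of `J^{d,n}_γ` for `d ≤ 10⁶` (all shifts) is a tree theorem bought from RH-verification to height, so a
kernel proof of a hyperbolicity rung at small `d` shows the kernel nothing new. The CAL proof of THEOREM α certifies a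
STRONGER, intrinsic inequality: the window polynomial has the SAME SIGN as its Laguerre–Bessel skeleton at every
critical point of the skeleton (`P(e) = P⁰(e)(1 + Σ_{m≥3} E_m R_m(e))`, `Σ E_m K_m < 1`). That inequality is a statement
about the numbers `γ(n), …, γ(n+d)` alone, implied by no zero-location theorem; it is what the DATA engine measured. -/

/-- Generic **sign certificate at the critical points of a hyperbolic skeleton**: `Q` ("skeleton") has
`deg Q = deg P ≥ 2` simple real zeros, the leading coefficients of `P` and `Q` have the same sign, and `P(e)·Q(e) > 0`
at every critical point `e` of `Q`. Soundness (support S1, PROVED as `SkeletonCertificate.splits_nodup` in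
`JensenPolynomialsSkeletonSound`): then `P` is hyperbolic with simple zeros (the `d−1` critical points of `Q` separate alternating signs of `Q`, hence of
`P`; two more zeros beyond the extreme critical points from the leading signs). ξ-free, RH-FREE. (HOME `JensenTargets` §2.) -/
structure SkeletonCertificate (P Q : ℝ[X]) : Prop where
  natDegree_eq : P.natDegree = Q.natDegree
  two_le : 2 ≤ Q.natDegree
  leadingCoeff_pos : 0 < P.leadingCoeff * Q.leadingCoeff
  splits : Q.Splits
  nodup : Q.roots.Nodup
  sameSign : ∀ e : ℝ, (derivative Q).eval e = 0 → 0 < P.eval e * Q.eval e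

/-- The **Appell (reversed Jensen) polynomial** `A^{d}_r(X) = Σ_{j ≤ d} (d choose j) r(j) X^{d−j} = r(D) Xᵈ`
(`r(D) = Σ r(j) Dʲ/j!`). For `r(0), r(d) ≠ 0` it is hyperbolic iff `J^{d,0}_r` is (roots `t ↦ 1/t`; for `t ≠ 0`,
`A^{d}_r(t) = tᵈ·J^{d,0}_r(1/t)`). The CAL's "x-frame" is this frame up to an affine change of variable, under which
`SkeletonCertificate` is invariant. (HOME `JensenTargets` §2.) -/
def appellPoly (r : ℕ → ℝ) (d : ℕ) : ℝ[X] :=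
  ∑ j ∈ range (d + 1), C ((d.choose j : ℝ) * r j) * X ^ (d - j)

/-- The **window sequence** of `γ` at shift `n` in units `γ(n) = 1`, `γ(n+1)/γ(n) = 1`:
`r_n(j) = γ(n+j)·γ(n)^{j−1}/γ(n+1)^j` (written `γ(n+j)γ(n)^j/(γ(n)γ(n+1)^j)` to avoid `ℕ`-subtraction; `r_n(0) = r_n(1) = 1`
for `γ(n), γ(n+1) ≠ 0`). `J^{d,n}_γ(ρX) = γ(n)·J^{d,0}_{r_n}(X)`, `ρ = γ(n)/γ(n+1)`, so for `γ > 0` hyperbolicity of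
`J^{d,n}_γ`, of `J^{d,0}_{r_n}` and of `appellPoly (windowSeq γ n) d` coincide (support S3, PROVED in
`JensenPolynomialsSkeletonLaguerre`). (HOME `JensenTargets` §2; DATA §9 `r_j`.) -/
def windowSeq (γ : ℕ → ℝ) (n j : ℕ) : ℝ :=
  γ (n + j) * γ n ^ j / (γ n * γ (n + 1) ^ j)

/-- `κ_n² := (b+1)(1 − r_n(2))`, `b = n + 1/2` — the Bessel parameter of the centred skeleton (matching the `w²` coefficient
of `log g`). For `γ = xiTaylorCoeff`, `κ_n² = (2n+3)·Δ(n+2)² > 0` by the strict Turán inequality (tree `xiDeltaSqPos_holds`).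
(HOME `JensenTargets` §2; DATA §9 `κ²`.) -/
def skelKappaSq (γ : ℕ → ℝ) (n : ℕ) : ℝ :=
  ((n : ℝ) + 3 / 2) * (1 - windowSeq γ n 2)

/-- `κ_n = √(κ_n²)` (total: `Real.sqrt`). (HOME `JensenTargets` §2.) -/
def skelKappa (γ : ℕ → ℝ) (n : ℕ) : ℝ := Real.sqrt (skelKappaSq γ n)

/-- `θ_n = 1 − κ_n` — the exponential tilt of the centred skeleton (matches the `w¹` coefficient). (HOME `JensenTargets` §2.) -/
def skelTheta (γ : ℕ → ℝ) (n : ℕ) : ℝ := 1 - skelKappa γ n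

/-- The **centred Laguerre–Bessel skeleton sequence** at shift `n`:
`s_n(j) = j!·[wʲ] e^{θ_n w} ₀F₁(; b ; b κ_n w) = Σ_{i ≤ j} (j choose i) θ_n^{j−i} (b κ_n)^i/(b)_i`, `b = n + 1/2`, `(b)_i` the
ascending Pochhammer symbol. Its Appell polynomial is the `θ_n`-translate of the reversed generalized Laguerre polynomial
`X^d·L_d^{(n−1/2)}(−bκ_n/X)` (support S2, PROVED in `JensenPolynomialsSkeletonLaguerre`; tree `JensenLaguerreSkeleton`,
`LaguerreZeros`). (HOME `JensenTargets` §2; DATA §9 `s_j`.) -/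
def skeletonSeq (γ : ℕ → ℝ) (n j : ℕ) : ℝ :=
  ∑ i ∈ range (j + 1), (j.choose i : ℝ) * skelTheta γ n ^ (j - i) *
    (((n : ℝ) + 1 / 2) * skelKappa γ n) ^ i / (ascPochhammer ℝ i).eval ((n : ℝ) + 1 / 2)

/-- **The skeleton sign test at `(d, n)`** for a sequence `γ`: the Appell polynomial of the window sequence carries a
`SkeletonCertificate` against the Appell polynomial of the centred skeleton. This is the inequality THEOREM α's CAL
certificate establishes cell by cell (`F(d,n) := Σ_{m=3}^{d} E_m K_m < 1` majorises its failure margin) and whose exact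
failure set / margin the DATA engine certified (DATA §9: `{n : ¬test} = [0, n_S(d))`, `n_S(3…20) = 0,0,3,5,9,13,17,22,27,32,
38,44,50,57,64,73,89,106`; ET7: `μ(d,n) := min_i P(e_i)/P⁰(e_i)` strictly increasing in `n`, `< 1`). (HOME `JensenTargets` §2.) -/
def SkeletonSignTest (γ : ℕ → ℝ) (d n : ℕ) : Prop :=
  SkeletonCertificate (appellPoly (windowSeq γ n) d) (appellPoly (skeletonSeq γ n) d)

/-- Schema: the skeleton sign test holds on the explicit cubic region `d ≥ 3, n ≥ n₀, p d³ ≤ q n`. RH-FREE. -/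
def SkeletonSignTestLaw (γ : ℕ → ℝ) (p q n₀ : ℕ) : Prop :=
  ∀ d n : ℕ, 3 ≤ d → n₀ ≤ n → p * d ^ 3 ≤ q * n → SkeletonSignTest γ d n

/-- **RH-FREE. PROOF-OF-DATA target P1⁺ (certificate form of THEOREM α).** On the region of `TheoremAlpha`
(`n ≥ 10⁴`, `27 d³ ≤ 200 n`) the skeleton sign test itself holds. Strictly stronger than `TheoremAlpha` (PROVED glue
`theoremAlpha_of_theoremAlphaCert`: S1 + S3); NOT implied by RH to any height, hence new as a statement at EVERY degree
`d ≥ 3`. Status: CERTIFIED (CAL, rh-explicit/jensen CLOSE-NOTE: TABLE Z + LEMMA R/L1, majorant `F < 1` with the 1.02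
bracket factor) and consistent with the column's DATA (D1: `n_S(d) ≤ ⌈0.135 d³⌉` for every `d ≤ 100`); NOT a tree theorem. -/
@[conjecture] def TheoremAlphaCert : Prop :=
  SkeletonSignTestLaw xiTaylorCoeff 27 200 10000

/-- **RH-FREE. Rung P1⁺.a (flat tier, certificate form)** — the theory seat's recommended FIRST KERNEL RUNG: for
`3 ≤ d ≤ 41` and every `n ≥ 10⁴` the skeleton sign test holds (`0.135·41³ < 10⁴`). Not a corollary of any RH-verification;
a kernel proof needs LEMMA Z′ (disc bound on `log(g/g^c)`, `n ≥ 10⁴`), LEMMA R/L1 (tree `LaguerreInterlacingRatios`) and the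
`d ≤ 41` bookkeeping. DATA (ET7, `d ≤ 20`): true failure margin `1 − μ(d,10⁴) = 0.00145 (d = 3) … 0.0705 (d = 20)`, the CAL
majorant carries `≥ 2.16×` slack. CERTIFIED (CAL), NOT a tree theorem. -/
@[conjecture] def TheoremAlphaCertFlat : Prop :=
  ∀ d n : ℕ, 3 ≤ d → d ≤ 41 → 10000 ≤ n → SkeletonSignTest xiTaylorCoeff d n

end Summit.RiemannHypothesis.RiemannHypothesis.Theorems.JensenPolynomials

end
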